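import Summits.AtomisticToContinuum.Crystallization.Theorems.ReggeStarCoercivityStabilityConstantTwelve
import Summits.AtomisticToContinuum.Crystallization.Theorems.ReggeStarCoercivityStabilityConstantTwelveNegWitnesses
import Literature.MathematicalPhysics.StatisticalMechanics.LennardJonesThermodynamicLimitProofs

/-!
# Route `ReggeStarCoercivity`, crux `StabilityConstantTwelve` (stmt-AtomisticToContinuum-13601) —
# equivalent forms of the statement (configuration form, thermodynamic form) and the double-counting reduction

Supporting file for the CLOSED item stmt-AtomisticToContinuum-13601 (`stabilityConstantTwelve_proof`,
`∀ N, -(N:ℝ) ≤ E(N)`, i.e. `B_LJ ≤ 12 ε`).  Port into `Theorems/` (LEAN-IN-TREE rule, 2026-08-18) of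
§0 and of the reduction of §5 of the disprover's crux workfile
`Summits/AtomisticToContinuum/Crystallization/Cruxes/StabilityConstantTwelve/Disproof.lean` (namespace
`….Cruxes.StabilityConstantTwelve.Disproof`, 2026-08-16; same names, statements and proofs verbatim).
These are the three declarations of that workfile which the publication bundle
`papers/AtomisticToContinuum/blj-12eps` cites (`[D]:98`, `[D]:112`, `[D]:771`) and which no
`Theorems/` module carried before this file; with it, every Summit-side declaration the bundle's paper
cites is Theorems-grade and lies in a Theorems-only generated enclosure.

* `stabilityConstantTwelve_iff_config` — the crux is the configuration statement
  `∀ N, ∀ x injective, -N ≤ Σ_{i<j} V_LJ(|xᵢ - xⱼ|)` (the infimum defining `E(N)` runs over a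
  non-empty type and is bounded above by every member);
* `stabilityConstantTwelve_iff_einf` — by the thermodynamic limit (Blanc–Lewin 2015 (8),
  `BlancLewin2015_8_holds`: `e_∞ = lim E(N)/N` exists and `e_∞ ≤ E(N)/N` for `N ≥ 1`) the crux is
  EQUIVALENT to `e_∞ ≥ -1`, i.e. to `B_LJ = -12 e_∞ ≤ 12 ε`;
* `stabilityConstantTwelve_of_sitewise` — double counting `2·𝓔_N = Σ_i (site energy of i)`: a
  one-centre bound `SitewiseTwelve δ` (every site energy `≥ -2` in `δ`-separated configurations,
  `….Theorems.StabilityConstantTwelveNegative.SitewiseTwelve`) at a separation `δ` valid for ground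
  states gives the crux.  (The strategy is dead at every separation currently proved for ground states:
  `not_sitewiseTwelve_0744` / `_0684` in `…NegWitnesses.lean`; recorded here because the paper cites the
  reduction when explaining why.)
-/

noncomputable section

namespace Summit.AtomisticToContinuum.Crystallization.Theorems.StabilityConstantTwelveNegative

open Literature.MathematicalPhysics.StatisticalMechanics
open Summit.AtomisticToContinuum.Crystallization.Theses.ReggeStarCoercivity (StabilityConstantTwelve)
open Filter Topology

/-! ## §0 Equivalent forms of the crux -/

/-- Configuration form: the crux is the statement `∑_{i<j} V_LJ(|xᵢ-xⱼ|) ≥ -N` for every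
INJECTIVE configuration of `N` points of `ℝ³` (the infimum defining `E(N)` is over a non-empty
family and is attained from above by every member).
[port of `…Cruxes.StabilityConstantTwelve.Disproof.stabilityConstantTwelve_iff_config`] -/
theorem stabilityConstantTwelve_iff_config :
    StabilityConstantTwelve ↔ ∀ (N : ℕ) (x : Fin N → EuclideanSpace ℝ (Fin 3)),
      Function.Injective x → -(N : ℝ) ≤ interactionEnergy lennardJones x := by
  constructor
  · intro h N x hx
    exact (h N).trans (groundStateEnergy_lennardJones_le hx)
  · intro h N
    haveI := nonempty_injective_config (d := 3) (by norm_num) N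
    exact le_ciInf fun x => h N x.1 x.2

/-- Thermodynamic form: the crux is EQUIVALENT to `e_∞ ≥ -1` for the limit
`e_∞ = lim E(N)/N` (which exists and equals `inf_{N ≥ 1} E(N)/N`, `BlancLewin2015_8_holds`).
Hence a disproof must exhibit ONE finite cluster with `E < -N`, and a proof may work at
`N → ∞` only.  In the paper's units, `B_LJ = -12·e_∞`, so this is `B_LJ ≤ 12 ε`.
[port of `…Cruxes.StabilityConstantTwelve.Disproof.stabilityConstantTwelve_iff_einf`] -/
theorem stabilityConstantTwelve_iff_einf :
    StabilityConstantTwelve ↔ ∀ e : ℝ,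
      Tendsto (fun N : ℕ => groundStateEnergy lennardJones 3 N / N) atTop (𝓝 e) → -1 ≤ e := by
  constructor
  · intro h e he
    refine ge_of_tendsto he ?_
    filter_upwards [eventually_gt_atTop 0] with N hN
    have hN' : (0 : ℝ) < N := by exact_mod_cast hN
    rw [le_div_iff₀ hN']
    have := h N
    linarith
  · intro h N
    obtain ⟨e, _, htend, hinf⟩ := BlancLewin2015_8_holds 3 (by norm_num) (by norm_num)
    have he := h e htend
    rcases Nat.eq_zero_or_pos N with rfl | hN
    · simp [groundStateEnergy_of_le_one lennardJones (zero_le_one)]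
    · have hN' : (0 : ℝ) < N := by exact_mod_cast hN
      have h1 := hinf N hN
      rw [le_div_iff₀ hN'] at h1
      nlinarith

/-! ## §5 The one-centre reduction (double counting) -/

/-- Double counting: a sitewise bound at the separation of ground states gives the crux
(the strategy the hedgehogs kill at `δ = 0.684`, `not_sitewiseTwelve_0684`; it revives only if BOTH a
larger separation is proved for ground states AND the hedgehog table says sitewise holds there).
[port of `…Cruxes.StabilityConstantTwelve.Disproof.stabilityConstantTwelve_of_sitewise`] -/
theorem stabilityConstantTwelve_of_sitewise {δ : ℝ}
    (hsep : ∀ (N : ℕ) (x : Fin N → EuclideanSpace ℝ (Fin 3)), IsGroundState lennardJones x →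
      ∀ i j, i ≠ j → δ ≤ dist (x i) (x j))
    (h : SitewiseTwelve δ) : StabilityConstantTwelve := by
  intro N
  obtain ⟨x, hx⟩ := exists_isGroundState_lennardJones (d := 3) (by norm_num) N
  rw [← hx.2]
  have h2 := two_mul_interactionEnergy lennardJones x
  have hs : ∀ i, -2 ≤ siteEnergy lennardJones x i := h N x (hsep N x hx)
  have := Finset.sum_le_sum fun i (_ : i ∈ Finset.univ) => hs i
  rw [Finset.sum_const, Finset.card_univ, Fintype.card_fin, nsmul_eq_mul] at this
  linarith

end Summit.AtomisticToContinuum.Crystallization.Theorems.StabilityConstantTwelveNegative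

end
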